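/-
Literature/NumberTheory/NumberFields/VanishingSumsRootsOfUnitySquarefree.lean — pub-hodgecm2 (COR-CM), KEPT Literature lane lit-deligne-3
gen 65, file F65d.  THEOREMS ONLY (no `def`, no named fact, no `sorry`, no instance, no notation; D-0026 net debt 0).  HC_CM is NOT proved.
-/
import Literature.NumberTheory.NumberFields.CyclotomicGaussianIndependence
import Mathlib.FieldTheory.Relrank
import Mathlib.Data.Fin.Tuple.Basic
import Mathlib.Algebra.BigOperators.Fin
import HarnessLib

/-!
# Vanishing sums of roots of unity of SQUAREFREE order `p₁⋯p_k`: linear disjointness of `ℚ(ζ_p)` and `ℚ(ζ_m)` (`p ∤ m`), and the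
# alternating-difference criterion `Σ_x f(x) μ₁^{x₁}⋯μ_k^{x_k} = 0 ⟺ all k-th mixed differences of f vanish` (Rédei ∕ de Bruijn ∕ Schoenberg)

Topic `Literature/NumberTheory/NumberFields` (namespace `Literature.NumberTheory.NumberFields.VanishingSumsSquarefree`); cell `pub-hodgecm2`
(COR-CM), KEPT Literature lane `lit-deligne-3` gen 65 (file F65d: the arithmetic input of the lane's SQUAREFREE-ODD-PART programme — kernels of
index `2p₁⋯p_k` in Kubota's rank count — generalising the two-prime files `DegenerateCMTypesCyclicTwoOddPrimes` (`pairSum_eq_zero_iff`) and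
`DegenerateCMTypesAbelianKernelsIndexTwoOddPrimes` (F64i, `pairSum_eq_zero_iff_forall_sub_eq`) to ANY number of distinct primes).  Mathlib and the
tree's `CyclotomicGaussianIndependence` (`finrank_adjoin_eq_totient`) only.  KERNEL ONLY: theorems; no `def`, no named fact, no instance, no
notation (D-0014 ∕ D-0026 net debt `0`).  HC_CM is NOT proved here or anywhere in the lane (nothing in this file concerns Hodge classes).

## Mathematics

Let `G = ⟨g⟩` be cyclic of order `m = p₁^{a₁}⋯p_r^{a_r}` and `φ : ℤG → ℤ[ζ_m]` the natural map.  T. Y. Lam and K. H. Leung [LamLeung2000, Thm. 2.2]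
(cf. Rédei, Hilfssatz 4; de Bruijn, Thm. 1; Schoenberg, Thm. 1): `ker φ = Σ_{i=1}^r ℤG · σ(P_i)`, `P_i` the subgroup of order `p_i`,
`σ(P_i) = Σ_{h ∈ P_i} h` — the ℤ-relations among the `m`-th roots of unity are generated by the (rotated) regular `p_i`-gons.  The proof is an
induction on `r` whose step is the LINEAR DISJOINTNESS of `ℚ(ζ_p)` and `ℚ(ζ_{m'})` for `p ∤ m'` («by a theorem of Kronecker», loc. cit. proof of
Thm. 3.3): `[ℚ(ζ_{pm'}) : ℚ] = φ(p)φ(m')` [Washington1997, Thm. 2.5], so `Φ_p` stays irreducible over `ℚ(ζ_{m'})` and the only `ℚ(ζ_{m'})`-linear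
relation among `1, ζ_p, …, ζ_p^{p−1}` is `1 + ζ_p + ⋯ + ζ_p^{p−1} = 0`.

For SQUAREFREE `m = p₁⋯p_k` (pairwise distinct primes; `ℤ/m = ℤ/p₁ × ⋯ × ℤ/p_k`) the theorem has an equivalent LOCAL form, which is what
the CM-type kernel decisions use: a function `f : ℤ/p₁ × ⋯ × ℤ/p_k → ℚ` lies in the span of the `p_i`-fibres (functions independent of the `i`-th
coordinate) iff every `k`-th MIXED DIFFERENCE vanishes,

  `Σ_{ε ∈ {0,1}^k} (−1)^{|ε|} f(x₁ + ε₁d₁, …, x_k + ε_kd_k) = 0`   for all base points `x` and displacements `d`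

(`k = 1`: `f` constant — the tree's `sum_mul_pow_eq_zero_iff_forall_eq`; `k = 2`: `f(a,b) + f(a',b') = f(a,b') + f(a',b)`, ADDITIVE SEPARABILITY —
the tree's `pairSum_eq_zero_iff` ∕ F64i).  This file proves, for pairwise distinct primes `p_i`, primitive `p_i`-th roots `μ_i ∈ ℂ` and rational `f`,

  **`Σ_x f(x) · μ₁^{x₁}⋯μ_k^{x_k} = 0 ⟺ all k-th mixed differences of f vanish`**  (`sum_mul_prod_pow_eq_zero_iff_forall_alternatingSum_eq_zero`),

by the induction of loc. cit.: split off the first coordinate, `Σ_x f(x) Π μ_i^{x_i} = Σ_a c_a μ₁^a` with `c_a = Σ_y f(a,y) Π_{i≥2} μ_i^{y_i} ∈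
ℚ(μ₂⋯μ_k) = ℚ(ζ_{p₂⋯p_k})`; by linear disjointness the outer sum vanishes iff all `c_a` agree, i.e. iff every ROW DIFFERENCE `f(a,·) − f(0,·)` is
a relation in `k − 1` variables; and the `(k)`-th mixed differences of `f` are the `(k−1)`-th mixed differences of its row differences.

* §1 TWO COPRIME CONDUCTORS: `isPrimitiveRoot_mul_of_coprime` (`μν` has order `ab`), `mem_adjoin_mul_of_coprime_left ∕ _right` (`μ, ν ∈ ℚ(μν)`, CRT
  exponent), `adjoin_pair_eq_adjoin_mul` (`ℚ(μ, ν) = ℚ(μν)`), `finrank_adjoin_pair` (`[ℚ(μ,ν):ℚ] = φ(a)φ(b)`).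
* §2 LINEAR DISJOINTNESS (`p` prime, `p ∤ m`): **`natDegree_minpoly_adjoin_eq`** (`[ℚ(ζ_m)(μ) : ℚ(ζ_m)] = p − 1`, tower law via Mathlib's
  `relfinrank`), **`cyclotomic_eq_minpoly_adjoin`** (`Φ_p` is the minimal polynomial of `μ` over `ℚ(ζ_m)` — irreducibility of `Φ_p` over a
  cyclotomic field of conductor prime to `p`), **`forall_eq_of_sum_mul_pow_eq_zero`** (`Σ_{x ∈ ℤ/p} c_x μˣ = 0` with `c_x ∈ ℚ(ζ_m)` forces all `c_x`
  equal; the coefficient comparison follows the tree's `CyclicTwoOddPrimes.sum_mul_pow_eq_zero_iff_forall_eq`, with `ℚ` replaced by `ℚ(ζ_m)`).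
* §3 FAMILIES of pairwise distinct primes: `isPrimitiveRoot_prod` (`Π μ_i` is a primitive `Π p_i`-th root), `mem_adjoin_prod` (`μ_j ∈ ℚ(Π μ_i)`).
* §4 THE CRITERION: private `alternatingSum_cons_sq` (splitting the alternating sum along the first coordinate:
  `Δ_{k+1} f (a∷y) (d∷e) = Δ_k f(a,·) y e − Δ_k f(a+d,·) y e`), **`sum_mul_prod_pow_eq_zero_iff_forall_alternatingSum_eq_zero`** (statement
  above; tuples as `Π i : Fin k, ZMod (p i)`, signs as `Π_i (if ε_i then −1 else 1)`, coefficients through `algebraMap ℚ ℂ`).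
* §5 (gen 65 append) THE GENERATOR FORM of [LamLeung2000] Thm. 2.2: `alternatingSum_eq_zero_of_update_eq` (a function independent of one
  coordinate has vanishing mixed differences — involution flipping `ε_i`), `forall_alternatingSum_eq_zero_of_eq_sum`,
  **`exists_eq_sum_of_forall_alternatingSum_eq_zero`** (vanishing mixed differences ⟹ `f = Σ_i F_i`, `F_i` invariant under `Function.update · i ·`;
  induction on `k` through the row differences), **`sum_mul_prod_pow_eq_zero_iff_exists_eq_sum`** (relation ⟺ `f` in the span of the `p_i`-fibres).
-- TODO(general form): prime powers `p^a ∥ m` (periodicity along `p^{a−1}ℤ/p^aℤ`, as in the tree's `…IndexFourMulPrimePower`).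

PRESEARCH (lane rule): corpus keyword «vanishing sums of roots of unity» → [corpus: paper:arxiv-math_9511209 = LamLeung2000, chunks p0034
(Thm. 2.2 with the Rédei ∕ de Bruijn ∕ Schoenberg attributions) and p0062 (Thm. 3.3, «ℚ(ζ_p) is linearly disjoint from ℚ(ζ_q) over ℚ (by a
theorem of Kronecker)»)] — the held arXiv text is font-garbled but the theorem numbers and statements are legible; also held: Conway–Jones 1976
(cited in paper:arxiv-1903.07314 p. 13), paper:arxiv-2008.11268 (minimal vanishing sums); corpus hybrid «linear relations among roots of unity
squarefree de Bruijn Rédei Schoenberg» (8 textbook hits, none stating Thm. 2.2); galaxy «vanishing sums of roots of unity | de Bruijn | Schoenberg»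
(earlier lane query, all stars: 0 relevant).  The mixed-difference form is recorded as the lane's own elementary reformulation with [LamLeung2000]
Thm. 2.2 ∕ 3.3 and [ConwayJones1976] Thm. 1 cited for the printed theorem.

HONEST REGISTER.  Unconditional and elementary (Mathlib's cyclotomic degree formula, the tower law, coefficient comparison).  Rational
coefficients only (the ℤ- and ℕ-coefficient refinements of loc. cit. — minimal vanishing sums, Thm. 3.3, the weight theorem 5.2 — are NOT
claimed).  Nothing here bears on Hodge classes; HC_CM is NOT proved and not used.

## References

* [LamLeung2000] T. Y. Lam, K. H. Leung, *On vanishing sums of roots of unity*, J. Algebra 224 (2000) 91–109 (arXiv:math/9511209): Thm. 2.2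
  (cf. L. Rédei, Hilfssatz 4; N. G. de Bruijn, *On the factorisation of cyclic groups* (1953), Thm. 1; I. J. Schoenberg (1964), Thm. 1), Thm. 3.3
  and its proof (linear disjointness).
* [ConwayJones1976] J. H. Conway, A. J. Jones, *Trigonometric diophantine equations (On vanishing sums of roots of unity)*, Acta Arith. 30
  (1976) 229–240, Thm. 1.
* [Washington1997] L. C. Washington, *Introduction to Cyclotomic Fields*, 2nd ed., GTM 83, Ch. 2: Prop. 2.4, Thm. 2.5.

## Provenance

Cell `pub-hodgecm2` (COR-CM), KEPT Literature lane `lit-deligne-3` gen 65 (claim VANISHING-SUMS-SQUAREFREE; count-neutral, own lane), file F65d;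
neighbours cited by name, nothing restated: `CyclotomicGaussianIndependence` (`finrank_adjoin_eq_totient`; its `eq_of_sum_mul_pow_eq_zero` is the
case `m = 1`), `DegenerateCMTypesCyclicTwoOddPrimes` (`sum_mul_pow_eq_zero_iff_forall_eq`, `pairSum_eq_zero_iff`: `k = 1, 2` over `ℚ`),
`DegenerateCMTypesAbelianKernelsIndexTwoOddPrimes` (F64i).  The `[folklore]` helpers are private (suffix `_sq`).  Theorems only; net Literature
debt 0.
-/

noncomputable section

open scoped BigOperators
open Polynomial IntermediateField

namespace Literature.NumberTheory.NumberFields.VanishingSumsSquarefree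

open Literature.NumberTheory.NumberFields.CyclotomicGaussian (finrank_adjoin_eq_totient)

/-! ## §1 Two cyclotomic fields of coprime conductors -/

section Coprime

variable {a b : ℕ} {μ ν : ℂ}

/-- The product of primitive roots of unity of coprime orders `a`, `b` is a primitive `ab`-th root of unity.
[cite: Washington1997, Ch. 2 Thm. 2.5] -/
theorem isPrimitiveRoot_mul_of_coprime (hab : a.Coprime b) (hμ : IsPrimitiveRoot μ a) (hν : IsPrimitiveRoot ν b) :
    IsPrimitiveRoot (μ * ν) (a * b) := by
  rw [IsPrimitiveRoot.iff_orderOf, (Commute.all μ ν).orderOf_mul_eq_mul_orderOf_of_coprime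
      (by rw [← hμ.eq_orderOf, ← hν.eq_orderOf]; exact hab), ← hμ.eq_orderOf, ← hν.eq_orderOf]

/-- `μ ∈ ℚ(μν)` for primitive roots `μ, ν` of coprime orders `a > 0`, `b`: `μ = (μν)^{bs}` with `bs ≡ 1 (mod a)`.
[cite: Washington1997, Ch. 2 Prop. 2.4] -/
theorem mem_adjoin_mul_of_coprime_left (ha : 0 < a) (hab : a.Coprime b) (hμ : IsPrimitiveRoot μ a)
    (hν : IsPrimitiveRoot ν b) : μ ∈ ℚ⟮μ * ν⟯ := by
  rcases Nat.lt_or_ge 1 a with ha1 | ha1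
  · obtain ⟨s, -, hs⟩ := Nat.exists_mul_mod_eq_one_of_coprime hab.symm ha1
    have h : (μ * ν) ^ (b * s) = μ := by
      rw [mul_pow, pow_mul ν, hν.pow_eq_one, one_pow, mul_one, ← pow_mod_orderOf, ← hμ.eq_orderOf, hs, pow_one]
    have key : (μ * ν) ^ (b * s) ∈ ℚ⟮μ * ν⟯ := pow_mem (mem_adjoin_simple_self ℚ (μ * ν)) (b * s)
    rwa [h] at key
  · have ha' : a = 1 := le_antisymm ha1 ha
    subst ha'
    rw [IsPrimitiveRoot.one_right_iff] at hμ
    rw [hμ]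
    exact one_mem _

/-- `ν ∈ ℚ(μν)` for primitive roots `μ, ν` of coprime orders `a`, `b > 0`. [cite: Washington1997, Ch. 2 Prop. 2.4] -/
theorem mem_adjoin_mul_of_coprime_right (hb : 0 < b) (hab : a.Coprime b) (hμ : IsPrimitiveRoot μ a)
    (hν : IsPrimitiveRoot ν b) : ν ∈ ℚ⟮μ * ν⟯ := by
  rw [mul_comm]
  exact mem_adjoin_mul_of_coprime_left hb hab.symm hν hμ

/-- `ℚ(μ, ν) = ℚ(μν)` for primitive roots of unity of coprime orders. [cite: Washington1997, Ch. 2 Prop. 2.4 and Thm. 2.5] -/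
theorem adjoin_pair_eq_adjoin_mul (ha : 0 < a) (hb : 0 < b) (hab : a.Coprime b) (hμ : IsPrimitiveRoot μ a)
    (hν : IsPrimitiveRoot ν b) : ℚ⟮μ, ν⟯ = ℚ⟮μ * ν⟯ := by
  refine le_antisymm (adjoin_le_iff.mpr ?_) (adjoin_simple_le_iff.mpr ?_)
  · intro x hx
    simp only [Set.mem_insert_iff, Set.mem_singleton_iff] at hx
    rcases hx with rfl | rfl
    · exact mem_adjoin_mul_of_coprime_left ha hab hμ hν
    · exact mem_adjoin_mul_of_coprime_right hb hab hμ hν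
  · exact mul_mem (subset_adjoin ℚ _ (Set.mem_insert _ _))
      (subset_adjoin ℚ _ (Set.mem_insert_of_mem _ (Set.mem_singleton _)))

/-- `[ℚ(μ, ν) : ℚ] = φ(a)φ(b)` for primitive roots of unity of coprime orders `a`, `b`. [cite: Washington1997, Ch. 2 Thm. 2.5] -/
theorem finrank_adjoin_pair (ha : 0 < a) (hb : 0 < b) (hab : a.Coprime b) (hμ : IsPrimitiveRoot μ a)
    (hν : IsPrimitiveRoot ν b) : Module.finrank ℚ ℚ⟮μ, ν⟯ = Nat.totient a * Nat.totient b := by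
  rw [adjoin_pair_eq_adjoin_mul ha hb hab hμ hν,
    finrank_adjoin_eq_totient (Nat.mul_pos ha hb) (isPrimitiveRoot_mul_of_coprime hab hμ hν), Nat.totient_mul hab]

end Coprime

/-! ## §2 Linear disjointness: `Φ_p` stays irreducible over `ℚ(ζ_m)` for `p ∤ m`, and the only `ℚ(ζ_m)`-relation among
`1, μ, …, μ^{p−1}` is the constant one -/

section Disjoint

variable {p m : ℕ} {μ ν : ℂ}

/-- **`[ℚ(ζ_m)(μ) : ℚ(ζ_m)] = p − 1`**: the degree of a primitive `p`-th root of unity over `ℚ(ν)`, `ν` a primitive `m`-th root,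
`p ∤ m` (`[ℚ(ζ_{pm}) : ℚ] = φ(p)φ(m)` and the tower law). [cite: Washington1997, Ch. 2 Prop. 2.4 and Thm. 2.5]
[cite: LamLeung2000, proof of Thm. 3.3 («linearly disjoint, by a theorem of Kronecker»)] -/
theorem natDegree_minpoly_adjoin_eq [hp : Fact p.Prime] (hm : 0 < m) (hpm : p.Coprime m) (hμ : IsPrimitiveRoot μ p)
    (hν : IsPrimitiveRoot ν m) : (minpoly ℚ⟮ν⟯ μ).natDegree = p - 1 := by
  have hp0 : 0 < p := hp.out.pos
  have hνint : IsIntegral ℚ ν := (hν.isIntegral hm).tower_top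
  have hμint : IsIntegral ℚ μ := (hμ.isIntegral hp0).tower_top
  haveI : FiniteDimensional ℚ ℚ⟮ν⟯ := adjoin.finiteDimensional hνint
  haveI : FiniteDimensional ℚ ℚ⟮ν, μ⟯ := finiteDimensional_adjoin_pair hνint hμint
  have hFE : ℚ⟮ν⟯ ≤ ℚ⟮ν, μ⟯ := adjoin.mono ℚ _ _ (Set.singleton_subset_iff.mpr (Set.mem_insert _ _))
  have hE : Module.finrank ℚ ℚ⟮ν, μ⟯ = Nat.totient m * (p - 1) := by
    rw [finrank_adjoin_pair hm hp0 hpm.symm hν hμ, Nat.totient_prime hp.out]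
  have h1 := finrank_bot_mul_relfinrank hFE
  rw [relfinrank_eq_finrank_of_le hFE, finrank_adjoin_eq_totient hm hν, hE] at h1
  have hdeg : Module.finrank ℚ⟮ν⟯ (extendScalars hFE) = p - 1 := Nat.eq_of_mul_eq_mul_left (Nat.totient_pos.mpr hm) h1
  have hKE : ℚ⟮ν⟯⟮μ⟯ = extendScalars hFE := by
    apply IntermediateField.restrictScalars_injective ℚ
    exact (adjoin_simple_adjoin_simple ℚ ν μ).trans (extendScalars_restrictScalars hFE).symm
  rw [← adjoin.finrank (hμint.tower_top (A := ℚ⟮ν⟯)), hKE, hdeg]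

/-- **`Φ_p` is the minimal polynomial of `μ` over `ℚ(ζ_m)`** (`p ∤ m`): irreducibility of the `p`-th cyclotomic polynomial over a
cyclotomic field of conductor prime to `p`. [cite: Washington1997, Ch. 2 Prop. 2.4 and Thm. 2.5] -/
theorem cyclotomic_eq_minpoly_adjoin [hp : Fact p.Prime] (hm : 0 < m) (hpm : p.Coprime m) (hμ : IsPrimitiveRoot μ p)
    (hν : IsPrimitiveRoot ν m) : cyclotomic p ℚ⟮ν⟯ = minpoly ℚ⟮ν⟯ μ := by
  have hp0 : 0 < p := hp.out.pos
  have hμint : IsIntegral ℚ⟮ν⟯ μ := ((hμ.isIntegral hp0).tower_top (A := ℚ)).tower_top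
  refine eq_of_monic_of_dvd_of_natDegree_le (minpoly.monic hμint) (cyclotomic.monic p _) (minpoly.dvd _ μ ?_) ?_
  · rw [aeval_def, eval₂_eq_eval_map, map_cyclotomic, ← IsRoot.def, isRoot_cyclotomic_iff]
    exact hμ
  · rw [natDegree_cyclotomic, natDegree_minpoly_adjoin_eq hm hpm hμ hν, Nat.totient_prime hp.out]

/-- Reindex a sum over `ZMod n` by the representatives `0, …, n − 1`. [folklore] -/
private theorem sum_zmod_eq_sum_range_sq {M : Type*} [AddCommMonoid M] {n : ℕ} [NeZero n] (f : ℕ → M) :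
    ∑ k : ZMod n, f k.val = ∑ k ∈ Finset.range n, f k := by
  refine Finset.sum_nbij' (fun k => k.val) (fun k => (k : ZMod n)) ?_ ?_ ?_ ?_ ?_
  · intro k _; exact Finset.mem_range.2 (ZMod.val_lt k)
  · intro k _; exact Finset.mem_univ _
  · intro k _; exact ZMod.natCast_zmod_val k
  · intro k hk; exact ZMod.val_cast_of_lt (Finset.mem_range.1 hk)
  · intro k _; rfl

/-- `Σ_{x ∈ ℤ/p} μˣ = 0` for a primitive `p`-th root of unity, `p` prime. [folklore] -/
private theorem sum_pow_val_eq_zero_sq [hp : Fact p.Prime] (hμ : IsPrimitiveRoot μ p) : ∑ x : ZMod p, μ ^ x.val = 0 := by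
  rw [sum_zmod_eq_sum_range_sq (fun k => μ ^ k)]
  exact hμ.geom_sum_eq_zero hp.out.one_lt

/-- **Linear disjointness of `ℚ(ζ_p)` and `ℚ(ζ_m)` (`p` prime, `p ∤ m`)**: if `Σ_{x ∈ ℤ/p} c_x μˣ = 0` with coefficients `c_x ∈ ℚ(ν)`
(`μ` a primitive `p`-th, `ν` a primitive `m`-th root of unity), then all `c_x` are EQUAL — the only `ℚ(ζ_m)`-relation among the
`p`-th roots of unity is `1 + μ + ⋯ + μ^{p−1} = 0`. [cite: LamLeung2000, Thm. 2.2 and proof of Thm. 3.3]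
[cite: Washington1997, Ch. 2 Prop. 2.4] -/
theorem forall_eq_of_sum_mul_pow_eq_zero [hp : Fact p.Prime] (hm : 0 < m) (hpm : p.Coprime m) (hμ : IsPrimitiveRoot μ p)
    (hν : IsPrimitiveRoot ν m) (c : ZMod p → ℂ) (hc : ∀ x, c x ∈ ℚ⟮ν⟯) (h : ∑ x : ZMod p, c x * μ ^ x.val = 0)
    (x : ZMod p) : c x = c 0 := by
  have hp1 : 1 < p := hp.out.one_lt
  -- the polynomial `P = Σ_x c_x X^x ∈ ℚ(ν)[X]` vanishes at `μ`
  set c' : ZMod p → ℚ⟮ν⟯ := fun y => ⟨c y, hc y⟩ with hc'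
  set P : (ℚ⟮ν⟯)[X] := ∑ y : ZMod p, C (c' y) * X ^ y.val with hP
  have hPμ : aeval μ P = 0 := by
    rw [hP, map_sum]
    simp only [map_mul, aeval_C, map_pow, aeval_X]
    exact h
  -- so `P = r · Φ_p` for a constant `r`
  have hdvd : cyclotomic p ℚ⟮ν⟯ ∣ P := by
    rw [cyclotomic_eq_minpoly_adjoin hm hpm hμ hν]
    exact minpoly.dvd _ μ hPμ
  obtain ⟨R, hR⟩ := hdvd
  have hdegΦ : (cyclotomic p ℚ⟮ν⟯).natDegree = p - 1 := by rw [natDegree_cyclotomic, Nat.totient_prime hp.out]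
  have hdegP : P.natDegree ≤ p - 1 := by
    rw [hP]
    refine natDegree_sum_le_of_forall_le _ _ fun y _ => ?_
    exact (natDegree_C_mul_X_pow_le (c' y) y.val).trans (by have := ZMod.val_lt y; omega)
  obtain ⟨r, hr⟩ : ∃ r : ℚ⟮ν⟯, P = C r * cyclotomic p ℚ⟮ν⟯ := by
    by_cases hR0 : R = 0
    · exact ⟨0, by rw [hR, hR0, mul_zero, map_zero, zero_mul]⟩
    · have hdeg := hdegP
      rw [hR, natDegree_mul (cyclotomic_ne_zero p _) hR0, hdegΦ] at hdeg
      have hR1 : R.natDegree = 0 := by omega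
      exact ⟨R.coeff 0, by rw [hR, mul_comm, ← eq_C_of_natDegree_eq_zero hR1]⟩
  -- compare coefficients: `c'_k = r` for every `k < p`
  have hcoefP : ∀ k : ℕ, k < p → P.coeff k = c' (k : ZMod p) := by
    intro k hk
    rw [hP, finsetSum_coeff]
    simp_rw [coeff_C_mul_X_pow]
    rw [Finset.sum_eq_single (k : ZMod p)]
    · rw [if_pos (ZMod.val_cast_of_lt hk).symm]
    · intro j _ hj
      rw [if_neg]
      intro hkj
      apply hj
      rw [hkj, ZMod.natCast_zmod_val]
    · intro hk'; exact absurd (Finset.mem_univ _) hk'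
  have hcoef : ∀ k : ℕ, k < p → c' (k : ZMod p) = r := by
    intro k hk
    rw [← hcoefP k hk, hr, coeff_C_mul, cyclotomic_prime, finsetSum_coeff]
    simp_rw [coeff_X_pow]
    rw [Finset.sum_ite_eq, if_pos (Finset.mem_range.2 hk), mul_one]
  have hall : ∀ y : ZMod p, c' y = r := fun y => by
    rw [← ZMod.natCast_zmod_val y]; exact hcoef _ (ZMod.val_lt y)
  have hx := hall x
  have h0 := hall 0
  rw [hc'] at hx h0
  have := congrArg Subtype.val (hx.trans h0.symm)
  exact this

end Disjoint

/-! ## §3 Families of distinct primes: the product root and the field it generates -/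

section Family

/-- For pairwise distinct primes `p_i` and primitive `p_i`-th roots `μ_i`, `Π μ_i` is a primitive `(Π p_i)`-th root of unity.
[cite: Washington1997, Ch. 2 Thm. 2.5] -/
theorem isPrimitiveRoot_prod : ∀ (k : ℕ) (p : Fin k → ℕ) (μ : Fin k → ℂ), (∀ i, (p i).Prime) → Function.Injective p →
    (∀ i, IsPrimitiveRoot (μ i) (p i)) → IsPrimitiveRoot (∏ i, μ i) (∏ i, p i)
  | 0, p, μ, _, _, _ => by
    rw [Fin.prod_univ_zero, Fin.prod_univ_zero]
    exact IsPrimitiveRoot.one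
  | k + 1, p, μ, hp, hinj, hμ => by
    rw [Fin.prod_univ_succ, Fin.prod_univ_succ]
    have htail := isPrimitiveRoot_prod k (fun i => p i.succ) (fun i => μ i.succ) (fun i => hp i.succ)
      (fun i j h => Fin.succ_injective _ (hinj h)) (fun i => hμ i.succ)
    have hcop : (p 0).Coprime (∏ i : Fin k, p i.succ) :=
      Nat.Coprime.prod_right fun i _ => (Nat.coprime_primes (hp 0) (hp i.succ)).2
        fun h => Fin.succ_ne_zero i (hinj h).symm
    exact isPrimitiveRoot_mul_of_coprime hcop (hμ 0) htail

/-- `p_0` is prime to `Π_{i ≥ 1} p_i` for pairwise distinct primes. [folklore] -/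
private theorem coprime_head_prod_tail_sq {k : ℕ} {p : Fin (k + 1) → ℕ} (hp : ∀ i, (p i).Prime)
    (hinj : Function.Injective p) : (p 0).Coprime (∏ i : Fin k, p i.succ) :=
  Nat.Coprime.prod_right fun i _ => (Nat.coprime_primes (hp 0) (hp i.succ)).2 fun h => Fin.succ_ne_zero i (hinj h).symm

/-- Every `μ_j` lies in `ℚ(Π_i μ_i)` (pairwise distinct primes). [cite: Washington1997, Ch. 2 Prop. 2.4] -/
theorem mem_adjoin_prod : ∀ (k : ℕ) (p : Fin k → ℕ) (μ : Fin k → ℂ), (∀ i, (p i).Prime) → Function.Injective p →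
    (∀ i, IsPrimitiveRoot (μ i) (p i)) → ∀ j, μ j ∈ ℚ⟮∏ i, μ i⟯
  | 0, _, _, _, _, _, j => j.elim0
  | k + 1, p, μ, hp, hinj, hμ, j => by
    rw [Fin.prod_univ_succ]
    have hinj' : Function.Injective (fun i : Fin k => p i.succ) := fun i j h => Fin.succ_injective _ (hinj h)
    have htail := isPrimitiveRoot_prod k (fun i => p i.succ) (fun i => μ i.succ) (fun i => hp i.succ) hinj'
      (fun i => hμ i.succ)
    have hcop := coprime_head_prod_tail_sq hp hinj
    refine Fin.cases ?_ (fun i => ?_) j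
    · exact mem_adjoin_mul_of_coprime_left (hp 0).pos hcop (hμ 0) htail
    · have hi := mem_adjoin_prod k (fun i => p i.succ) (fun i => μ i.succ) (fun i => hp i.succ) hinj' (fun i => hμ i.succ) i
      have hle : ℚ⟮∏ i : Fin k, μ i.succ⟯ ≤ ℚ⟮μ 0 * ∏ i : Fin k, μ i.succ⟯ :=
        adjoin_simple_le_iff.mpr (mem_adjoin_mul_of_coprime_right
          (Finset.prod_pos fun i _ => (hp i.succ).pos) hcop (hμ 0) htail)
      exact hle hi

end Family

/-! ## §4 Vanishing sums over `ℤ/p₁ × ⋯ × ℤ/p_k` (squarefree conductor): the alternating-difference criterion -/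

section Vanishing

/-- Splitting of the alternating sum along the first coordinate. [folklore] -/
private theorem alternatingSum_cons_sq {k : ℕ} {p : Fin (k + 1) → ℕ} (f : (Π i, ZMod (p i)) → ℚ)
    (a d : ZMod (p 0)) (y e : Π i : Fin k, ZMod (p i.succ)) :
    ∑ ε : Fin (k + 1) → Bool, (∏ i, (if ε i then (-1 : ℚ) else 1)) *
        f (fun i => if ε i then (Fin.cons a y : Π i, ZMod (p i)) i + (Fin.cons d e : Π i, ZMod (p i)) i
          else (Fin.cons a y : Π i, ZMod (p i)) i) =
      ∑ ε : Fin k → Bool, (∏ i, (if ε i then (-1 : ℚ) else 1)) *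
          f (Fin.cons a (fun i => if ε i then y i + e i else y i)) -
        ∑ ε : Fin k → Bool, (∏ i, (if ε i then (-1 : ℚ) else 1)) *
          f (Fin.cons (a + d) (fun i => if ε i then y i + e i else y i)) := by
  rw [← Fintype.sum_equiv (Fin.consEquiv fun _ : Fin (k + 1) => Bool)
    (fun bε => (∏ i, (if (Fin.cons bε.1 bε.2 : Fin (k + 1) → Bool) i then (-1 : ℚ) else 1)) *
      f (fun i => if (Fin.cons bε.1 bε.2 : Fin (k + 1) → Bool) i then
        (Fin.cons a y : Π i, ZMod (p i)) i + (Fin.cons d e : Π i, ZMod (p i)) i else (Fin.cons a y : Π i, ZMod (p i)) i))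
    _ (fun _ => rfl), Fintype.sum_prod_type, Fintype.sum_bool]
  have hpt : ∀ (b : Bool) (ε : Fin k → Bool),
      (fun i => if (Fin.cons b ε : Fin (k + 1) → Bool) i then
        (Fin.cons a y : Π i, ZMod (p i)) i + (Fin.cons d e : Π i, ZMod (p i)) i else (Fin.cons a y : Π i, ZMod (p i)) i) =
      (Fin.cons (if b then a + d else a) (fun i => if ε i then y i + e i else y i) : Π i, ZMod (p i)) := by
    intro b ε
    funext i
    refine Fin.cases ?_ (fun j => ?_) i
    · simp only [Fin.cons_zero]
    · simp only [Fin.cons_succ]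
  have hsign : ∀ (b : Bool) (ε : Fin k → Bool),
      (∏ i, (if (Fin.cons b ε : Fin (k + 1) → Bool) i then (-1 : ℚ) else 1)) =
        (if b then (-1 : ℚ) else 1) * ∏ i, (if ε i then (-1 : ℚ) else 1) := by
    intro b ε
    rw [Fin.prod_univ_succ]
    simp only [Fin.cons_zero, Fin.cons_succ]
  simp_rw [hpt, hsign]
  simp only [ite_true, ite_false, Bool.false_eq_true, one_mul]
  rw [add_comm, sub_eq_add_neg, ← Finset.sum_neg_distrib]
  congr 1
  exact Finset.sum_congr rfl fun ε _ => by ring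

/-- **Vanishing sums of roots of unity of squarefree order — the alternating-difference criterion** (Rédei ∕ de Bruijn ∕ Schoenberg,
in the form of [LamLeung2000] Thm. 2.2 for `m = p₁⋯p_k` squarefree, rational coefficients).  For pairwise distinct primes `p_i`,
primitive `p_i`-th roots of unity `μ_i ∈ ℂ` and `f : ℤ/p₁ × ⋯ × ℤ/p_k → ℚ`:

  `Σ_x f(x) · Π_i μ_i^{x_i} = 0  ⟺  Σ_{ε ∈ {0,1}^k} (−1)^{|ε|} f(x + ε·d) = 0` for all base points `x` and all displacements `d`,

i.e. every `k`-th MIXED DIFFERENCE of `f` vanishes (`k = 1`: `f` constant; `k = 2`: `f(a,b) + f(a',b') = f(a,b') + f(a',b)`, ADDITIVE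
SEPARABILITY; in general: `f` is a sum of functions each independent of one coordinate — the relation module is generated by the
`p_i`-fibres).  Proof by induction on `k`: split off the first coordinate; the inner sums lie in `ℚ(μ₂⋯μ_k) = ℚ(ζ_{p₂⋯p_k})`, and by
linear disjointness (`forall_eq_of_sum_mul_pow_eq_zero`) the outer relation holds iff all inner sums agree, i.e. iff every row
difference `f(a, ·) − f(0, ·)` is a relation in `k − 1` variables. [cite: LamLeung2000, Thm. 2.2 (cf. Rédei Hilfssatz 4, de Bruijn Thm. 1,
Schoenberg Thm. 1) and Thm. 3.3] [cite: ConwayJones1976, Thm. 1] -/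
theorem sum_mul_prod_pow_eq_zero_iff_forall_alternatingSum_eq_zero :
    ∀ (k : ℕ) (p : Fin k → ℕ) [∀ i, NeZero (p i)] (μ : Fin k → ℂ), (∀ i, (p i).Prime) → Function.Injective p →
      (∀ i, IsPrimitiveRoot (μ i) (p i)) → ∀ f : (Π i, ZMod (p i)) → ℚ,
      (∑ x : (Π i, ZMod (p i)), algebraMap ℚ ℂ (f x) * ∏ i, μ i ^ (x i).val = 0 ↔
        ∀ x d : (Π i, ZMod (p i)),
          ∑ ε : Fin k → Bool, (∏ i, (if ε i then (-1 : ℚ) else 1)) * f (fun i => if ε i then x i + d i else x i) = 0)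
  | 0, p, _, μ, _, _, _, f => by
    have hx : ∀ x : (Π i : Fin 0, ZMod (p i)), x = default := fun x => Subsingleton.elim _ _
    simp only [Fintype.sum_unique, Finset.univ_eq_empty, Finset.prod_empty, mul_one, one_mul, map_eq_zero]
    constructor
    · intro h x d
      convert h using 2
    · intro h
      have h0 := h default default
      convert h0 using 2
  | k + 1, p, inst, μ, hp, hinj, hμ, f => by
    haveI : Fact (p 0).Prime := ⟨hp 0⟩
    have hinj' : Function.Injective (fun i : Fin k => p i.succ) := fun i j h => Fin.succ_injective _ (hinj h)
    -- the tail root `ν = μ₂⋯μ_k`, a primitive `m`-th root, `m = p₂⋯p_k` prime to `p₁`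
    have hν := isPrimitiveRoot_prod k (fun i => p i.succ) (fun i => μ i.succ) (fun i => hp i.succ) hinj' (fun i => hμ i.succ)
    have hm : 0 < ∏ i : Fin k, p i.succ := Finset.prod_pos fun i _ => (hp i.succ).pos
    have hcop := coprime_head_prod_tail_sq hp hinj
    have hmem : ∀ j : Fin k, μ j.succ ∈ ℚ⟮∏ i : Fin k, μ i.succ⟯ :=
      mem_adjoin_prod k (fun i => p i.succ) (fun i => μ i.succ) (fun i => hp i.succ) hinj' (fun i => hμ i.succ)
    -- the induction hypothesis for the row differences
    have IH := fun g => sum_mul_prod_pow_eq_zero_iff_forall_alternatingSum_eq_zero k (fun i => p i.succ)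
      (fun i => μ i.succ) (fun i => hp i.succ) hinj' (fun i => hμ i.succ) g
    -- inner sums
    set c : ZMod (p 0) → ℂ := fun a => ∑ y : (Π i : Fin k, ZMod (p i.succ)),
      algebraMap ℚ ℂ (f (Fin.cons a y)) * ∏ i, μ i.succ ^ (y i).val with hc
    have hcmem : ∀ a, c a ∈ ℚ⟮∏ i : Fin k, μ i.succ⟯ := fun a =>
      sum_mem fun y _ => mul_mem (IntermediateField.algebraMap_mem _ _) (prod_mem fun i _ => pow_mem (hmem i) _)
    -- Step 1: the total sum, split along the first coordinate
    have hsplit : ∑ x : (Π i, ZMod (p i)), algebraMap ℚ ℂ (f x) * ∏ i, μ i ^ (x i).val =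
        ∑ a : ZMod (p 0), c a * μ 0 ^ a.val := by
      rw [← Fintype.sum_equiv (Fin.consEquiv fun i => ZMod (p i))
        (fun ay => algebraMap ℚ ℂ (f (Fin.cons ay.1 ay.2)) * ∏ i, μ i ^ ((Fin.cons ay.1 ay.2 : Π i, ZMod (p i)) i).val)
        _ (fun _ => rfl), Fintype.sum_prod_type]
      refine Finset.sum_congr rfl fun a _ => ?_
      rw [hc, Finset.sum_mul]
      refine Finset.sum_congr rfl fun y _ => ?_
      rw [Fin.prod_univ_succ]
      simp only [Fin.cons_zero, Fin.cons_succ]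
      ring
    -- Step 2: linear disjointness — the total sum vanishes iff all inner sums agree
    have hstep2 : ∑ a : ZMod (p 0), c a * μ 0 ^ a.val = 0 ↔ ∀ a, c a = c 0 := by
      constructor
      · intro h a
        exact forall_eq_of_sum_mul_pow_eq_zero hm hcop (hμ 0) hν c hcmem h a
      · intro h
        simp_rw [h]  -- every `c a` becomes `c 0`
        rw [← Finset.mul_sum, sum_pow_val_eq_zero_sq (hμ 0), mul_zero]
    -- Step 3: `c a = c 0` iff the row difference `f(a,·) − f(0,·)` is a relation in `k` variables
    have hstep3 : ∀ a, c a = c 0 ↔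
        ∑ y : (Π i : Fin k, ZMod (p i.succ)), algebraMap ℚ ℂ (f (Fin.cons a y) - f (Fin.cons 0 y)) *
          ∏ i, μ i.succ ^ (y i).val = 0 := by
      intro a
      rw [← sub_eq_zero, hc]
      simp only [map_sub, sub_mul, Finset.sum_sub_distrib]
    -- Step 4: alternating sums of a row difference
    have hstep4 : ∀ a (y e : Π i : Fin k, ZMod (p i.succ)),
        ∑ ε : Fin k → Bool, (∏ i, (if ε i then (-1 : ℚ) else 1)) *
            (fun z : (Π i : Fin k, ZMod (p i.succ)) => f (Fin.cons a z) - f (Fin.cons 0 z))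
              (fun i => if ε i then y i + e i else y i) =
          ∑ ε : Fin k → Bool, (∏ i, (if ε i then (-1 : ℚ) else 1)) * f (Fin.cons a (fun i => if ε i then y i + e i else y i)) -
            ∑ ε : Fin k → Bool, (∏ i, (if ε i then (-1 : ℚ) else 1)) *
              f (Fin.cons 0 (fun i => if ε i then y i + e i else y i)) := by
      intro a y e
      rw [← Finset.sum_sub_distrib]
      refine Finset.sum_congr rfl fun ε _ => ?_
      simp only
      ring
    -- assemble
    rw [hsplit, hstep2]
    simp_rw [hstep3]
    constructor
    · intro h x d
      rw [← Fin.cons_self_tail x, ← Fin.cons_self_tail d, alternatingSum_cons_sq]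
      have hx0 := (IH _).1 (h (x 0)) (Fin.tail x) (Fin.tail d)
      have hx1 := (IH _).1 (h (x 0 + d 0)) (Fin.tail x) (Fin.tail d)
      rw [hstep4] at hx0 hx1
      linear_combination hx0 - hx1
    · intro h a
      refine (IH _).2 fun y e => ?_
      rw [hstep4]
      have h1 := h (Fin.cons a y) (Fin.cons (-a) e)
      rw [alternatingSum_cons_sq, add_neg_cancel] at h1
      linear_combination h1

end Vanishing

/-! ## §5 (gen 65 append) The generator form: vanishing mixed differences ⟺ `f` is a sum of functions each independent of one coordinate
([LamLeung2000] Thm. 2.2: `ker φ = Σ_i ℤG·σ(P_i)`, rational version for squarefree conductor) -/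

section Generators

/-- A function independent of the `i`-th coordinate (an element of `ℚG·σ(P_i)`) has vanishing `k`-th mixed differences (pair `ε` with `ε` flipped at
`i`). [cite: LamLeung2000, Thm. 2.2 (the inclusion `⊇`: `σ(P_i) ∈ ker φ`)] -/
theorem alternatingSum_eq_zero_of_update_eq {k : ℕ} {p : Fin k → ℕ} (F : (Π j, ZMod (p j)) → ℚ) (i : Fin k)
    (hF : ∀ (x : Π j, ZMod (p j)) (t : ZMod (p i)), F (Function.update x i t) = F x) (x d : Π j, ZMod (p j)) :
    ∑ ε : Fin k → Bool, (∏ j, (if ε j then (-1 : ℚ) else 1)) * F (fun j => if ε j then x j + d j else x j) = 0 := by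
  -- the sign flips and the point moves only in the `i`-th coordinate under `ε ↦ update ε i (!ε i)`
  have hsign : ∀ (ε : Fin k → Bool) (b : Bool), (∏ j, (if Function.update ε i b j then (-1 : ℚ) else 1)) =
      (if b then (-1 : ℚ) else 1) * ∏ j ∈ Finset.univ.erase i, (if ε j then (-1 : ℚ) else 1) := by
    intro ε b
    rw [← Finset.mul_prod_erase _ _ (Finset.mem_univ i), Function.update_self]
    congr 1
    exact Finset.prod_congr rfl fun j hj => by rw [Function.update_of_ne (Finset.mem_erase.1 hj).1]
  have hpt : ∀ (ε : Fin k → Bool) (b : Bool),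
      (fun j => if Function.update ε i b j then x j + d j else x j) =
        Function.update (fun j => if ε j then x j + d j else x j) i (if b then x i + d i else x i) := by
    intro ε b
    funext j
    by_cases hj : j = i
    · subst hj; rw [Function.update_self, Function.update_self]
    · rw [Function.update_of_ne hj, Function.update_of_ne hj]
  refine Finset.sum_ninvolution (fun ε => Function.update ε i (!ε i)) (fun ε => ?_) (fun ε _ => ?_) (fun ε => Finset.mem_univ _)
    (fun ε => ?_)
  · -- `g ε + g (flip ε) = 0`
    have hεε : ε = Function.update ε i (ε i) := (Function.update_eq_self i ε).symm
    rw [hpt ε (!ε i), hF, hsign ε (!ε i)]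
    conv_lhs => rw [hεε, hsign ε (ε i), ← hεε]
    cases ε i <;> simp
  · -- the flip moves `ε`
    intro hεq
    have := congrFun hεq i
    rw [Function.update_self] at this
    exact Bool.not_ne_self _ this
  · -- flipping twice is the identity
    rw [Function.update_self, Bool.not_not, Function.update_idem, Function.update_eq_self]

/-- A sum of functions each independent of one coordinate has vanishing mixed differences. [cite: LamLeung2000, Thm. 2.2 (the inclusion `⊇`)] -/
theorem forall_alternatingSum_eq_zero_of_eq_sum {k : ℕ} {p : Fin k → ℕ} (f : (Π j, ZMod (p j)) → ℚ)
    (F : Fin k → (Π j, ZMod (p j)) → ℚ) (hF : ∀ i (x : Π j, ZMod (p j)) (t : ZMod (p i)), F i (Function.update x i t) = F i x)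
    (hf : ∀ x, f x = ∑ i, F i x) (x d : Π j, ZMod (p j)) :
    ∑ ε : Fin k → Bool, (∏ j, (if ε j then (-1 : ℚ) else 1)) * f (fun j => if ε j then x j + d j else x j) = 0 := by
  simp_rw [hf, Finset.mul_sum]
  rw [Finset.sum_comm]
  exact Finset.sum_eq_zero fun i _ => alternatingSum_eq_zero_of_update_eq (F i) i (hF i) x d

/-- Row differences of a function with vanishing `(k+1)`-th mixed differences have vanishing `k`-th mixed differences. [folklore] -/
private theorem forall_alternatingSum_rowDiff_sq {k : ℕ} {p : Fin (k + 1) → ℕ} (f : (Π i, ZMod (p i)) → ℚ)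
    (h : ∀ x d : (Π i, ZMod (p i)),
      ∑ ε : Fin (k + 1) → Bool, (∏ i, (if ε i then (-1 : ℚ) else 1)) * f (fun i => if ε i then x i + d i else x i) = 0)
    (a : ZMod (p 0)) (y e : Π i : Fin k, ZMod (p i.succ)) :
    ∑ ε : Fin k → Bool, (∏ i, (if ε i then (-1 : ℚ) else 1)) *
      (fun z : (Π i : Fin k, ZMod (p i.succ)) => f (Fin.cons a z) - f (Fin.cons 0 z)) (fun i => if ε i then y i + e i else y i) = 0 := by
  have h1 := h (Fin.cons 0 y) (Fin.cons a e)
  rw [alternatingSum_cons_sq, zero_add] at h1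
  have hsplit : ∑ ε : Fin k → Bool, (∏ i, (if ε i then (-1 : ℚ) else 1)) *
      (fun z : (Π i : Fin k, ZMod (p i.succ)) => f (Fin.cons a z) - f (Fin.cons 0 z)) (fun i => if ε i then y i + e i else y i) =
      ∑ ε : Fin k → Bool, (∏ i, (if ε i then (-1 : ℚ) else 1)) * f (Fin.cons a (fun i => if ε i then y i + e i else y i)) -
        ∑ ε : Fin k → Bool, (∏ i, (if ε i then (-1 : ℚ) else 1)) * f (Fin.cons 0 (fun i => if ε i then y i + e i else y i)) := by
    rw [← Finset.sum_sub_distrib]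
    refine Finset.sum_congr rfl fun ε _ => ?_
    simp only
    ring
  rw [hsplit]
  linear_combination -h1

/-- **Vanishing mixed differences ⟹ `f` is a sum of coordinate-invariant functions** (the inclusion `⊆` of [LamLeung2000] Thm. 2.2 for a squarefree
conductor, rational coefficients): by induction on `k`, `f(a∷y) = f(0∷y) + Σ_i F^a_i(y)` with `F^a_i` from the row differences. [cite: LamLeung2000, Thm. 2.2] -/
theorem exists_eq_sum_of_forall_alternatingSum_eq_zero :
    ∀ (k : ℕ) (p : Fin k → ℕ) (f : (Π i, ZMod (p i)) → ℚ),
      (∀ x d : (Π i, ZMod (p i)),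
        ∑ ε : Fin k → Bool, (∏ i, (if ε i then (-1 : ℚ) else 1)) * f (fun i => if ε i then x i + d i else x i) = 0) →
      ∃ F : Fin k → (Π i, ZMod (p i)) → ℚ,
        (∀ i (x : Π j, ZMod (p j)) (t : ZMod (p i)), F i (Function.update x i t) = F i x) ∧ ∀ x, f x = ∑ i, F i x
  | 0, p, f, h => by
    refine ⟨fun i => i.elim0, fun i => i.elim0, fun x => ?_⟩
    rw [Finset.univ_eq_empty, Finset.sum_empty]
    have h0 := h x x
    rw [Fintype.sum_unique] at h0
    simp only [Finset.univ_eq_empty, Finset.prod_empty, one_mul] at h0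
    convert h0 using 2
  | k + 1, p, f, h => by
    have hrow := forall_alternatingSum_rowDiff_sq f h
    choose Fa hFa hsum using fun a : ZMod (p 0) =>
      exists_eq_sum_of_forall_alternatingSum_eq_zero k (fun i => p i.succ)
        (fun z => f (Fin.cons a z) - f (Fin.cons 0 z)) (fun y e => hrow a y e)
    refine ⟨fun i => Fin.cases (motive := fun _ => (Π j, ZMod (p j)) → ℚ) (fun x => f (Fin.cons 0 (Fin.tail x)))
      (fun i' x => Fa (x 0) i' (Fin.tail x)) i, fun i => ?_, fun x => ?_⟩
    · refine Fin.cases ?_ (fun i' => ?_) i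
      · intro x t
        simp only [Fin.cases_zero, Fin.tail_update_zero]
      · intro x t
        simp only [Fin.cases_succ, Fin.tail_update_succ, hFa]
        rw [Function.update_of_ne (Fin.succ_ne_zero i').symm]
    · rw [Fin.sum_univ_succ]
      simp only [Fin.cases_zero, Fin.cases_succ]
      have hx := hsum (x 0) (Fin.tail x)
      simp only [Fin.cons_self_tail] at hx
      linear_combination hx

/-- **The generator form of the relation theorem** ([LamLeung2000] Thm. 2.2 = Rédei ∕ de Bruijn ∕ Schoenberg, squarefree conductor, rational coefficients):
for pairwise distinct primes `p_i` and primitive `p_i`-th roots `μ_i`, a rational `f` on `Πℤ/p_i` is a relation `Σ_x f(x)Πμ_i^{x_i} = 0` iff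
`f = Σ_i F_i` with `F_i` independent of the `i`-th coordinate (invariant under `Function.update · i ·`), i.e. `f` lies in the span of the
`p_i`-fibres `ℚG·σ(P_i)`. [cite: LamLeung2000, Thm. 2.2 (cf. Rédei Hilfssatz 4, de Bruijn Thm. 1, Schoenberg Thm. 1)] [cite: ConwayJones1976, Thm. 1] -/
theorem sum_mul_prod_pow_eq_zero_iff_exists_eq_sum {k : ℕ} {p : Fin k → ℕ} [∀ i, NeZero (p i)] {μ : Fin k → ℂ}
    (hp : ∀ i, (p i).Prime) (hinj : Function.Injective p) (hμ : ∀ i, IsPrimitiveRoot (μ i) (p i)) (f : (Π i, ZMod (p i)) → ℚ) :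
    ∑ x : (Π i, ZMod (p i)), algebraMap ℚ ℂ (f x) * ∏ i, μ i ^ (x i).val = 0 ↔
      ∃ F : Fin k → (Π i, ZMod (p i)) → ℚ,
        (∀ i (x : Π j, ZMod (p j)) (t : ZMod (p i)), F i (Function.update x i t) = F i x) ∧ ∀ x, f x = ∑ i, F i x := by
  rw [sum_mul_prod_pow_eq_zero_iff_forall_alternatingSum_eq_zero k p μ hp hinj hμ f]
  constructor
  · exact exists_eq_sum_of_forall_alternatingSum_eq_zero k p f
  · rintro ⟨F, hF, hf⟩ x d
    exact forall_alternatingSum_eq_zero_of_eq_sum f F hF hf x d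

end Generators

end Literature.NumberTheory.NumberFields.VanishingSumsSquarefree

end
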